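import Literature.IUT.HodgeTheaters.GlobalFrobenioidsArithmeticPullback
import Literature.AlgebraicGeometry.Frobenioids.Cor411AsPrinted
import Literature.AlgebraicGeometry.Frobenioids.ModelFrobenioidNoAnchors
import Literature.AlgebraicGeometry.Frobenioids.ArithmeticFrobenioidRational
import Literature.AlgebraicGeometry.Frobenioids.MotivatingExamplesSubProofs3
import Literature.AlgebraicGeometry.Frobenioids.ArithmeticDivisorsPerfFactorial
import Literature.AnabelianGeometry.SemiGraphs.CosetCategoriesSlimTempered
import Literature.AnabelianGeometry.AbsoluteAnabelian.NFSlimKummerProofs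
import HarnessLib

/-!
# [IUTchI] Example 5.1 (ii)/(iii): [FrdI] Corollary 4.11 ON EQUIVALENCES of the GENUINE global model
# Frobenioids `ℱ^⊛(†𝒟^⊚)` over `†𝒟^⊛ = ℬ(G)⁰` — standard type, the typed Cor. 4.11 (ii), the `1`-unique
# `Ψ^Base : ℬ(G₁)⁰ ⥲ ℬ(G₂)⁰`, Frobenius degrees and the Cor. 4.11 (iv) data `(Ψ^Base, η, Ψ^Φ)`

S. Mochizuki, *Inter-universal Teichmüller theory I*, §5, Example 5.1 (ii)/(iii), kurims manuscript (May 2020)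
p. 125 ([IUTchI] Ex 5.1 (iii) p.125) [claim: Mochizuki2012, status: disputed]: "this data determines, by applying
[FrdI], Theorem 5.2, (ii), a model Frobenioid `ℱ^⊛(†𝒟^⊚)` over the base category `†𝒟^⊛`" … "Let `†ℱ^⊛` be any
category equivalent to `ℱ^⊛(†𝒟^⊚)`.  Thus, `†ℱ^⊛` is equipped with a natural Frobenioid structure [cf. [FrdI],
Corollary 4.11; [FrdI], Theorem 6.4, (i); Remark 3.1.5 of the present paper]"; and Corollary 5.3 (i) p. 144
(whose proof, p. 144 l. 31–36, reads `Base(−)` of a category equivalent to `†ℱ^⊛` through [FrdI] Cor. 4.11).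
The mathematics is S. Mochizuki, *The geometry of Frobenioids I*, Kyushu J. Math. **62** (2008), Cor. 4.11
pp. 91–92 [cite: MochizukiFrdI2008, Cor. 4.11 p.91], Thm. 5.2 (iii) p. 101 [cite: MochizukiFrdI2008, Thm. 5.2(iii) p.101]
and Thm. 6.4 (i) p. 114 [cite: MochizukiFrdI2008, Thm. 6.4 (i) p.114].

PROOF-ONLY file (cell abc-iut; seat abc-iut-w4-d109, an L1 base on loan to the L5 hub; row «C53i/M2
COR411-AT-GLOBAL-MODEL-FROBENIOID» = the (m2) residual of `plan/L5` SUBDAG-IUTchI-Cor53 §A: "[FrdI] Cor 4.11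
base functor ON EQUIVALENCES at the global model Frobenioid"), 0 definitions.  The carriers are the GENUINE
global model Frobenioids of the tree: abc-iut-L5's `(GlobalDivisorData.arithAlong F ρ hρ).ModelGlobalFrobenioid`
over `ℬ(G)⁰ = BaseCat G` for EVERY profinite `G = π₁(†𝒟^⊛)` with a continuous surjection `ρ : G ↠ G_F`
(`GlobalFrobenioidsArithmeticPullback.lean`) and `(GlobalDivisorData.arith F).ModelGlobalFrobenioid` over
`ℬ(G_F)⁰` (`GlobalFrobenioidsArithmeticModel.lean`), whose divisor data are abc-iut-L1's [FrdI] Ex. 6.3 data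
composed with a functor `S : ℬ(G)⁰ ⥤ FinSubextCat F F̄`.  Everything is L1's Cor. 4.11 closers
(`Cor411AsPrinted.lean`, abc-iut-L1-d6) APPLIED at these carriers:

* §1 (generic, any functor `S : D ⥤ FinSubextCat F K`): the composite divisor monoid `Φ ∘ S` is sharp,
  perf-factorial, NON-DILATING and non-zero — these transfer along ANY functor objectwise / arrow-wise — so,
  by L1's [FrdI] Thm. 5.2 (iii) `ModelFrobenioid.data_isOfStandardType_of`, the model Frobenioid of
  `(Φ ∘ S, B ∘ S, Div ∘ S)` is of STANDARD TYPE and NOT of group-like type as soon as `D` is totally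
  epimorphic, non-empty and of FSM-type; and every object is RATIONAL at THE birationalization (Def. 4.5 (ii);
  L1's `ModelFrobenioid.isStrictlyRational_biratData_iff` fed, exactly as in abc-iut-L6-t10's
  `isStrictlyRational_arith`, by the rational function with positive divisor at a given place);
* §2: `ℬ(G)⁰` is SLIM for a slim profinite `G` ([SemiAnbd] Rmk. 3.4.1 at the temperoid, transported along
  `ℬ(G)⁰ ≌ B^temp(G)⁰`), and `G_F` IS slim for a number field `F` ([AbsAnab] Thm. 1.1.1 (ii), PROVED in the tree:
  abc-iut-L4's `galoisNF_slim_holds`);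
* §3 (`arithAlong F ρ hρ`, every `G ↠ G_F`): STANDARD TYPE and not group-like UNCONDITIONALLY; the TYPED
  [FrdI] Cor. 4.11 (ii) `Cor411ii` for EVERY equivalence `Ψ` between two such models UNCONDITIONALLY
  (`FrdI.cor411ii_ofFunctor`); `Cor411Setting`, hence the `1`-unique `Ψ^Base : ℬ(G₁)⁰ ⥲ ℬ(G₂)⁰` with its
  `1`-commutative square and both composites rigid, "`Ψ` preserves `deg_Fr`", and the Cor. 4.11 (iv) consumer
  data `(Ψ^Base, η, Ψ^Φ)` with the divisor formula on all arrows — MODULO ONLY `IsSlimGroup G_i` (print's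
  standing slimness of `π₁(†𝒟^⊛)`, a displayed hypothesis, not a new named fact);
* (companion `GlobalFrobenioidsArithmeticCor411GF.lean`, §4: the same for `arith F`, `G = G_F` itself, with NO
  hypothesis — `G_F` is slim.)

HONEST LIMITS.  This removes the (m2) piece of the after-merge residual of `IUTchI:Cor5.3(i)` only; the (m3) piece
(Ex. 5.1 (v) / [AbsTopIII] Thm. 1.9) is FACT-policy and untouched; no node token flips.  A theorem about OUR model
Frobenioids over `ℬ(G)⁰`; nothing here bears on, or takes a side on, [IUTchIII] Cor. 3.12, and nothing asserts
anything about abc.  Typed ≠ proved for everything not stated here.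
-/

noncomputable section

-- `(PreFrobenioidData.ofFunctor Φ F).base` / `ModelFrobenioid.data` unfold only at default transparency.
set_option backward.isDefEq.respectTransparency false

namespace Literature.IUT.HodgeTheaters

open CategoryTheory Opposite NumberField
open Literature.AlgebraicGeometry.Frobenioids Literature.AnabelianGeometry.SemiGraphs
open Literature.AlgebraicGeometry.Frobenioids.QuasiTemperoid
open Literature.AlgebraicGeometry.Frobenioids.PreFrobenioid

universe v u

/-! ### §1. Arithmetic divisor data composed with ANY functor `S : D ⥤ FinSubextCat F K` -/

section Composite

variable {F : Type} [Field F] [NumberField F] {K : Type} [Field K] [Algebra F K]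
variable {D : Type u} [Category.{v} D] (S : D ⥤ FinSubextCat F K)

/-- `Φ ∘ S` has SHARP values (each `Φ(L)` is divisorial, [FrdI] Ex. 6.3 p. 113).
[cite: MochizukiFrdI2008, Ex. 6.3 p.113] -/
theorem objectwise_isSharp_arithDivisorFunctor_comp :
    Objectwise (fun M _ => IsSharp M) (S.op ⋙ arithDivisorFunctor F K) :=
  fun A => (arithDivisorFunctor_isDivisorial F K (S.obj A)).isSharp

/-- `Φ ∘ S` is PERF-FACTORIAL objectwise ([FrdI] Ex. 6.3 p. 113 "perf-factorial"; abc-iut-L1-d2's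
`EffArithDivisor.isPerfFactorial`). [cite: MochizukiFrdI2008, Ex. 6.3 p.113] -/
theorem objectwise_isPerfFactorial_arithDivisorFunctor_comp :
    Objectwise (fun M _ => IsPerfFactorial M) (S.op ⋙ arithDivisorFunctor F K) :=
  fun A => EffArithDivisor.isPerfFactorial (S.obj A).L

/-- `Φ ∘ S` is NON-DILATING ([FrdI] Def. 1.1 (ii)): an endomorphism `α` of `A ∈ Ob(D)` acts on
`Φ(S A)` through the endomorphism `S α` of the number field `S A`, for which abc-iut-L6-t10's
`arithDivisorFunctor_isNonDilatingOn` ([FrdI] Thm. 6.4 (i) "`Φ` is non-dilating", p. 115) applies.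
[cite: MochizukiFrdI2008, Thm. 6.4 (i) p.115] -/
theorem isNonDilatingOn_arithDivisorFunctor_comp : IsNonDilatingOn (S.op ⋙ arithDivisorFunctor F K) :=
  fun A α => arithDivisorFunctor_isNonDilatingOn F K (S.obj A) (S.map α)

/-- `Φ ∘ S` is NOT the zero monoid as soon as `D` has an object ("`Φ` is nonzero", [FrdI] Thm. 6.4 (i) p. 115:
the divisor `δ_v` at an archimedean place of the number field `S A` is nonzero).
[cite: MochizukiFrdI2008, Thm. 6.4 (i) p.115] -/
theorem not_isZeroMonoid_arithDivisorFunctor_comp [Nonempty D] :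
    ¬ ModelFrobenioid.IsZeroMonoid (S.op ⋙ arithDivisorFunctor F K) := by
  intro h
  obtain ⟨A⟩ := (inferInstance : Nonempty D)
  obtain ⟨w⟩ : Nonempty (InfinitePlace (S.obj A).L) := inferInstance
  have h1 := h (op A) (Multiplicative.ofAdd (EffArithDivisor.single (S.obj A).L (Sum.inl w)))
  have h2 : EffArithDivisor.psupp (EffArithDivisor.single (S.obj A).L (Sum.inl w)) = ∅ :=
    EffArithDivisor.psupp_eq_empty_iff.mpr (Multiplicative.ofAdd.injective h1)
  rw [EffArithDivisor.psupp_single] at h2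
  exact Set.singleton_ne_empty _ h2

/-- **[FrdI] Thm. 5.2 (iii) at the composite data: the model Frobenioid of `(Φ ∘ S, B ∘ S, Div ∘ S)` is of
STANDARD TYPE** whenever `D` is non-empty, totally epimorphic and of FSM-type (hence FSMFF-type) — L1's
`ModelFrobenioid.data_isOfStandardType_of` with its clauses discharged: `B ∘ S` group-like, `Φ ∘ S` sharp,
non-zero (clause (a) vacuous) and non-dilating. [cite: MochizukiFrdI2008, Thm. 5.2(iii) p.101] -/
theorem isOfStandardType_model_arith_comp [Nonempty D] (he : IsTotallyEpimorphic D) (hfsm : IsOfFSMType D) :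
    (ModelFrobenioid.data (S.op ⋙ arithDivisorFunctor F K) (S.op ⋙ unitsFunctor F K)
      (Functor.whiskerLeft S.op (divNatTrans F K))).IsOfStandardType :=
  ModelFrobenioid.data_isOfStandardType_of _ _ _ (objectwise_comp S (unitsFunctor_isGroupLike F K))
    (objectwise_isSharp_arithDivisorFunctor_comp S) he
    (fun h0 => (not_isZeroMonoid_arithDivisorFunctor_comp S h0).elim) hfsm.isOfFSMFFType
    (isNonDilatingOn_arithDivisorFunctor_comp S)

/-- … and is NOT of group-like type ("`Φ` is nonzero [so `C` is not of group-like type]", [FrdI] Thm. 6.4 (i)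
p. 115; L1's `ModelFrobenioid.data_isOfGroupLikeType_iff`). [cite: MochizukiFrdI2008, Thm. 6.4 (i) p.115] -/
theorem not_isOfGroupLikeType_model_arith_comp [Nonempty D] :
    ¬ (ModelFrobenioid.data (S.op ⋙ arithDivisorFunctor F K) (S.op ⋙ unitsFunctor F K)
      (Functor.whiskerLeft S.op (divNatTrans F K))).IsOfGroupLikeType :=
  fun h => not_isZeroMonoid_arithDivisorFunctor_comp S
    ((ModelFrobenioid.data_isOfGroupLikeType_iff _ _ _).mp h)

/-- **Every object of the model Frobenioid of `(Φ ∘ S, B ∘ S, Div ∘ S)` is STRICTLY RATIONAL at THE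
birationalization and the primary support** ([FrdI] Def. 4.5 (ii); Thm. 6.4 (i) p. 115 l. 37–38 "it is immediate
from the definition of `B` that `C` is of rational type") — abc-iut-L6-t10's argument (`isStrictlyRational_arith`)
run at the number field `S(A_D)`: for the prime at a place `p` take `g ∈ B(S A_D) = S(A_D)^×` with `div(g) > 0`
at `p` (abc-iut-L1-t1's data row `Thm64i_L08_strictlyRational_data_holds`) and the positive / negative parts of
`div(g)`. [cite: MochizukiFrdI2008, Thm. 6.4 (i) p.115] -/
theorem isStrictlyRational_biratData_model_arith_comp
    (hF : IsFrobenioid (ModelFrobenioid.toElem (S.op ⋙ arithDivisorFunctor F K) (S.op ⋙ unitsFunctor F K)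
      (Functor.whiskerLeft S.op (divNatTrans F K))))
    (A : ModelFrobenioid (S.op ⋙ arithDivisorFunctor F K) (S.op ⋙ unitsFunctor F K)
      (Functor.whiskerLeft S.op (divNatTrans F K))) :
    PreFrobenioidData.IsStrictlyRational (biratData hF (hasBiratSquares_of_isFrobenioid hF))
      (S := ModelFrobenioid.data (S.op ⋙ arithDivisorFunctor F K) (S.op ⋙ unitsFunctor F K)
        (Functor.whiskerLeft S.op (divNatTrans F K)))
      (fun a 𝔭 => PrimarySupp a 𝔭) A := by
  refine (ModelFrobenioid.isStrictlyRational_biratData_iff (objectwise_comp S (unitsFunctor_isGroupLike F K))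
    (objectwise_comp S (arithDivisorFunctor_isDivisorial F K)) hF (hasBiratSquares_of_isFrobenioid hF)
    (fun a 𝔭 => PrimarySupp a 𝔭) A).mpr fun 𝔭 => ?_
  -- a primary representative of `𝔭`, supported at a single place `p` of the number field `L = S(A_D)`
  obtain ⟨⟨a₀, ha₀⟩, rfl⟩ := Quotient.exists_rep 𝔭
  let D₀ : EffArithDivisor (S.obj A.base).L := Multiplicative.toAdd (α := EffArithDivisor (S.obj A.base).L) a₀
  have ha₀' : IsPrimary (Multiplicative.ofAdd D₀) := ha₀
  obtain ⟨p, hp⟩ := EffArithDivisor.isPrimary_iff.mp ha₀'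
  -- a rational function with positive divisor at `p`, and the positive/negative parts of its divisor
  obtain ⟨g, hg⟩ := arith_exists_rational_function_pos Thm64i_L08_strictlyRational_data_holds (S.obj A.base).L p
  obtain ⟨a, b, hab, ha_fin, ha_inf, hb_fin, hb_inf⟩ :=
    EffArithDivisor.exists_pos_neg (principalArithDivisor (S.obj A.base).L g)
  have hpa : p ∈ EffArithDivisor.psupp a := by
    rcases p with v | w
    · exact (ha_inf v).mpr hg
    · exact (ha_fin w).mpr hg
  have hpb : p ∉ EffArithDivisor.psupp b := by
    rcases p with v | w
    · exact fun h => lt_asymm hg ((hb_inf v).mp h)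
    · exact fun h => lt_asymm hg ((hb_fin w).mp h)
  refine ⟨Multiplicative.ofAdd a, Multiplicative.ofAdd b, ⟨g, ?_⟩, ?_, ?_⟩
  · -- `[a]/[b] = Div_B(g)` in `Φ(L)^gp`
    exact EffArithDivisor.of_div_of_eq_gpEquiv_symm a b _ hab
  · -- `𝔭 ∈ Supp(a)`: `a₀ ≼ a` since `supp a₀ = {p} ⊆ supp a`
    refine ⟨Multiplicative.ofAdd D₀, ha₀', rfl, EffArithDivisor.precsim_iff_psupp_subset.mpr ?_⟩
    rw [hp, Set.singleton_subset_iff]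
    exact hpa
  · -- `𝔭 ∉ Supp(b)`: a primary `a₁ ~ a₀` with `a₁ ≼ b` would put `p` in `supp b`
    rintro ⟨a₁, ha₁, hrep, hprec⟩
    have h10 : Precsim a₁ (Multiplicative.ofAdd D₀) := Quotient.exact hrep
    have h01 : Precsim (Multiplicative.ofAdd D₀) a₁ := ha₀'.2 a₁ ha₁.1 h10
    have hsub := EffArithDivisor.precsim_iff_psupp_subset.mp (h01.trans hprec)
    rw [hp, Set.singleton_subset_iff] at hsub
    exact hpb hsub

/-- Hence every object is RATIONAL ([FrdI] Def. 4.5 (ii)) at THE birationalization and the primary support —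
the binder `hrat₁` of L1's Cor. 4.11 (iii)/(iv) closers. [cite: MochizukiFrdI2008, Def. 4.5 (ii) p.86] -/
theorem isRational_biratData_model_arith_comp
    (hF : IsFrobenioid (ModelFrobenioid.toElem (S.op ⋙ arithDivisorFunctor F K) (S.op ⋙ unitsFunctor F K)
      (Functor.whiskerLeft S.op (divNatTrans F K))))
    (A : ModelFrobenioid (S.op ⋙ arithDivisorFunctor F K) (S.op ⋙ unitsFunctor F K)
      (Functor.whiskerLeft S.op (divNatTrans F K))) :
    PreFrobenioidData.IsRational (biratData hF (hasBiratSquares_of_isFrobenioid hF))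
      (S := ModelFrobenioid.data (S.op ⋙ arithDivisorFunctor F K) (S.op ⋙ unitsFunctor F K)
        (Functor.whiskerLeft S.op (divNatTrans F K)))
      (fun a 𝔭 => PrimarySupp a 𝔭) A :=
  ⟨A, 𝟙 A, PreFrobenioidData.isPullbackMorphism_id _ A, isStrictlyRational_biratData_model_arith_comp S hF A⟩

end Composite

/-! ### §2. Slimness of `ℬ(G)⁰`; `G_F` is slim -/

/-- **`†𝒟^⊛ = ℬ(G)⁰` is a SLIM category for a slim profinite group `G`** ([FrdI] §0 p. 14; [SemiAnbd] Rmk. 3.4.1,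
the tree's `isSlim_connectedPart_bTemp` at the temperoid `B^temp(G)⁰`, every profinite group being tempered,
transported along the equivalence `ℬ(G)⁰ ≌ B^temp(G)⁰`, `BCat.connectedToBTemp`).
([IUTchI] Ex 5.1 (i) p.123) [claim: Mochizuki2012, status: disputed] -/
theorem isSlim_baseCat_of_isSlimGroup (G : ProfiniteGrp.{u}) (hZ : IsSlimGroup G) : IsSlim (BaseCat G) := by
  haveI := BCat.connectedToBTemp_isEquivalence (G := G)
  exact (isSlim_connectedPart_bTemp (IsTempered.of_profinite (G := G)) hZ).of_equivalence
    (BCat.connectedToBTemp G).asEquivalence.symm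

/-- **`G_F = Gal(F̄/F)` is slim for a number field `F`** ([AbsAnab] Thm. 1.1.1 (ii); PROVED in the tree by
abc-iut-L4, `galoisNF_slim_holds`), for L5's profinite group `absGalGrp F`.
([IUTchI] Ex 5.1 (i) p.123) [claim: Mochizuki2012, status: disputed] -/
theorem isSlimGroup_absGalGrp (F : Type) [Field F] [NumberField F] : IsSlimGroup (absGalGrp F) :=
  Literature.AnabelianGeometry.AbsoluteAnabelian.galoisNF_slim_holds F

/-- Hence **`†𝒟^⊛ = ℬ(G_F)⁰` is slim**, unconditionally. ([IUTchI] Ex 5.1 (i) p.123) [claim: Mochizuki2012, status: disputed] -/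
theorem isSlim_baseCat_absGalGrp (F : Type) [Field F] [NumberField F] : IsSlim (BaseCat (absGalGrp F)) :=
  isSlim_baseCat_of_isSlimGroup (absGalGrp F) (isSlimGroup_absGalGrp F)

/-! ### §3. `ℱ^⊛(†𝒟^⊚)` over `†𝒟^⊛ = ℬ(G)⁰`, `G = π₁(†𝒟^⊛) ↠ G_F` (`arithAlong`) -/

namespace GlobalDivisorData

section Along

variable {G : ProfiniteGrp.{0}} (F : Type) [Field F] [NumberField F] (ρ : G →ₜ* GalFbar F)
  (hρ : Function.Surjective ρ)

/-- **`ℱ^⊛(†𝒟^⊚)` over `ℬ(G)⁰` is of STANDARD TYPE, unconditionally** ([FrdI] Thm. 5.2 (iii) / Thm. 6.4 (i):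
`ℬ(G)⁰` totally epimorphic, non-empty, of FSM-type; `Φ^⊛` sharp, non-zero, non-dilating).
([IUTchI] Ex 5.1 (ii) p.125) [claim: Mochizuki2012, status: disputed] -/
theorem isOfStandardType_arithAlong :
    (ModelFrobenioid.data (arithAlong F ρ hρ).Φ (arithAlong F ρ hρ).B (arithAlong F ρ hρ).div).IsOfStandardType := by
  haveI : Nonempty (BaseCat G) := (isGraphConnected_baseCat G).nonempty
  exact isOfStandardType_model_arith_comp (subfieldFunctor F ρ hρ) (isTotallyEpimorphic_baseCat G)
    (isOfFSMType_baseCat G)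

/-- **`ℱ^⊛(†𝒟^⊚)` over `ℬ(G)⁰` is NOT of group-like type** ([FrdI] Thm. 6.4 (i): `Φ^⊛ ≠ 0`).
([IUTchI] Ex 5.1 (ii) p.125) [claim: Mochizuki2012, status: disputed] -/
theorem not_isOfGroupLikeType_arithAlong :
    ¬ (ModelFrobenioid.data (arithAlong F ρ hρ).Φ (arithAlong F ρ hρ).B (arithAlong F ρ hρ).div).IsOfGroupLikeType := by
  haveI : Nonempty (BaseCat G) := (isGraphConnected_baseCat G).nonempty
  exact not_isOfGroupLikeType_model_arith_comp (subfieldFunctor F ρ hρ)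

/-- `Φ^⊛` over `ℬ(G)⁰` is perf-factorial objectwise ([FrdI] §4 standing assumption p. 75; Ex. 6.3).
([IUTchI] Ex 5.1 (ii) p.125) [claim: Mochizuki2012, status: disputed] -/
theorem objectwise_isPerfFactorial_arithAlong :
    Objectwise (fun M _ => IsPerfFactorial M) (arithAlong F ρ hρ).Φ :=
  objectwise_isPerfFactorial_arithDivisorFunctor_comp (subfieldFunctor F ρ hρ)

/-- Every object of `ℱ^⊛(†𝒟^⊚)` over `ℬ(G)⁰` is RATIONAL at THE birationalization ([FrdI] Def. 4.5 (ii)).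
([IUTchI] Ex 5.1 (ii) p.125) [claim: Mochizuki2012, status: disputed] -/
theorem isRational_biratData_arithAlong (A : (arithAlong F ρ hρ).ModelGlobalFrobenioid) :
    PreFrobenioidData.IsRational
      (biratData (isFrobenioid_arithAlong F ρ hρ) (hasBiratSquares_of_isFrobenioid (isFrobenioid_arithAlong F ρ hρ)))
      (S := ModelFrobenioid.data (arithAlong F ρ hρ).Φ (arithAlong F ρ hρ).B (arithAlong F ρ hρ).div)
      (fun a 𝔭 => PrimarySupp a 𝔭) A :=
  isRational_biratData_model_arith_comp (subfieldFunctor F ρ hρ) (isFrobenioid_arithAlong F ρ hρ) A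

end Along

section AlongTwo

variable {G₁ : ProfiniteGrp.{0}} (F₁ : Type) [Field F₁] [NumberField F₁] (ρ₁ : G₁ →ₜ* GalFbar F₁)
  (hρ₁ : Function.Surjective ρ₁)
variable {G₂ : ProfiniteGrp.{0}} (F₂ : Type) [Field F₂] [NumberField F₂] (ρ₂ : G₂ →ₜ* GalFbar F₂)
  (hρ₂ : Function.Surjective ρ₂)

/-- **[FrdI] Cor. 4.11 (ii) AS TYPED, UNCONDITIONALLY, for EVERY equivalence `Ψ : ℱ^⊛(¹𝒟^⊚) ⥲ ℱ^⊛(²𝒟^⊚)`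
of global model Frobenioids over `ℬ(G₁)⁰`, `ℬ(G₂)⁰`** (abc-iut-L1-d6's `FrdI.cor411ii_ofFunctor`: its only inputs
are "Frobenioid" and "`Φ` perf-factorial", both theorems here). This is the [FrdI] Cor. 4.11 that [IUTchI]
Ex. 5.1 (iii) cites for "`†ℱ^⊛` is equipped with a natural Frobenioid structure" and that the proof of Cor. 5.3 (i)
reads `Base(−)` through. ([IUTchI] Ex 5.1 (iii) p.125) [claim: Mochizuki2012, status: disputed] -/
theorem cor411ii_arithAlong
    (Ψ : (arithAlong F₁ ρ₁ hρ₁).ModelGlobalFrobenioid ≌ (arithAlong F₂ ρ₂ hρ₂).ModelGlobalFrobenioid) :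
    (ModelFrobenioid.data (arithAlong F₁ ρ₁ hρ₁).Φ (arithAlong F₁ ρ₁ hρ₁).B (arithAlong F₁ ρ₁ hρ₁).div).Cor411ii
      (ModelFrobenioid.data (arithAlong F₂ ρ₂ hρ₂).Φ (arithAlong F₂ ρ₂ hρ₂).B (arithAlong F₂ ρ₂ hρ₂).div) Ψ :=
  FrdI.cor411ii_ofFunctor (isFrobenioid_arithAlong F₁ ρ₁ hρ₁) (isFrobenioid_arithAlong F₂ ρ₂ hρ₂) Ψ
    (objectwise_isPerfFactorial_arithAlong F₁ ρ₁ hρ₁) (objectwise_isPerfFactorial_arithAlong F₂ ρ₂ hρ₂)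

/-- **The hypothesis package `Cor411Setting` of [FrdI] Cor. 4.11 HOLDS for every such `Ψ`, modulo only the
slimness of the groups `G_i = π₁(ⁱ𝒟^⊛)`** (p. 91: `D_i` Div-slim — slim ⇒ Div-slim, Def. 4.5 (iv); `C_i` of
standard type — unconditional; (b) idle, the models not being group-like).
([IUTchI] Ex 5.1 (iii) p.125) [claim: Mochizuki2012, status: disputed] -/
theorem cor411Setting_arithAlong (hZ₁ : IsSlimGroup G₁) (hZ₂ : IsSlimGroup G₂)
    (Ψ : (arithAlong F₁ ρ₁ hρ₁).ModelGlobalFrobenioid ≌ (arithAlong F₂ ρ₂ hρ₂).ModelGlobalFrobenioid) :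
    (ModelFrobenioid.data (arithAlong F₁ ρ₁ hρ₁).Φ (arithAlong F₁ ρ₁ hρ₁).B (arithAlong F₁ ρ₁ hρ₁).div).Cor411Setting
      (ModelFrobenioid.data (arithAlong F₂ ρ₂ hρ₂).Φ (arithAlong F₂ ρ₂ hρ₂).B (arithAlong F₂ ρ₂ hρ₂).div) Ψ where
  divSlim := ⟨PreFrobenioidData.isDivSlim_of_isSlim _ (isSlim_baseCat_of_isSlimGroup G₁ hZ₁),
    PreFrobenioidData.isDivSlim_of_isSlim _ (isSlim_baseCat_of_isSlimGroup G₂ hZ₂)⟩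
  standard := ⟨isOfStandardType_arithAlong F₁ ρ₁ hρ₁, isOfStandardType_arithAlong F₂ ρ₂ hρ₂⟩
  hypB h₁ _ := absurd h₁ (not_isOfGroupLikeType_arithAlong F₁ ρ₁ hρ₁)

/-- **The `1`-unique `Ψ^Base : ℬ(G₁)⁰ ⥲ ℬ(G₂)⁰` induced by `Ψ`** ([FrdI] Cor. 4.11 (ii) p. 91: a `1`-unique
`1`-commutative square over the base functors `ℱ^⊛(ⁱ𝒟^⊚) → ℬ(G_i)⁰`, `Ψ^Base` an equivalence, both composite
functors rigid) — for slim `G₁, G₂`. ([IUTchI] Ex 5.1 (iii) p.125) [claim: Mochizuki2012, status: disputed] -/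
theorem exists_oneUniqueSquare_base_arithAlong (hZ₁ : IsSlimGroup G₁) (hZ₂ : IsSlimGroup G₂)
    (Ψ : (arithAlong F₁ ρ₁ hρ₁).ModelGlobalFrobenioid ≌ (arithAlong F₂ ρ₂ hρ₂).ModelGlobalFrobenioid) :
    ∃ ΨBase : BaseCat G₁ ⥤ BaseCat G₂,
      PreFrobenioidData.OneUniqueSquare Ψ.functor (arithAlong F₁ ρ₁ hρ₁).modelBase (arithAlong F₂ ρ₂ hρ₂).modelBase
          ΨBase ∧
        IsRigidFunctor (Ψ.functor ⋙ (arithAlong F₂ ρ₂ hρ₂).modelBase) ∧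
        IsRigidFunctor ((arithAlong F₁ ρ₁ hρ₁).modelBase ⋙ ΨBase) := by
  obtain ⟨ΨBase, hsq, hrig⟩ :=
    cor411ii_arithAlong F₁ ρ₁ hρ₁ F₂ ρ₂ hρ₂ Ψ (cor411Setting_arithAlong F₁ ρ₁ hρ₁ F₂ ρ₂ hρ₂ hZ₁ hZ₂ Ψ)
  exact ⟨ΨBase, hsq, hrig (isSlim_baseCat_of_isSlimGroup G₁ hZ₁) (isSlim_baseCat_of_isSlimGroup G₂ hZ₂)⟩

/-- **"`Ψ` preserves Frobenius degrees"** ([FrdI] Thm. 3.4 (iii) / Cor. 4.11 (iv), p. 94) for every equivalence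
of global model Frobenioids over slim `ℬ(G_i)⁰` (L1's `FrdI.preservesDegFr_of_cor411Setting`).
([IUTchI] Ex 5.1 (iii) p.125) [claim: Mochizuki2012, status: disputed] -/
theorem preservesDegFr_arithAlong (hZ₁ : IsSlimGroup G₁) (hZ₂ : IsSlimGroup G₂)
    (Ψ : (arithAlong F₁ ρ₁ hρ₁).ModelGlobalFrobenioid ≌ (arithAlong F₂ ρ₂ hρ₂).ModelGlobalFrobenioid) :
    PreFrobenioidData.PreservesDegFr
      (ModelFrobenioid.data (arithAlong F₁ ρ₁ hρ₁).Φ (arithAlong F₁ ρ₁ hρ₁).B (arithAlong F₁ ρ₁ hρ₁).div)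
      (ModelFrobenioid.data (arithAlong F₂ ρ₂ hρ₂).Φ (arithAlong F₂ ρ₂ hρ₂).B (arithAlong F₂ ρ₂ hρ₂).div) Ψ :=
  FrdI.preservesDegFr_of_cor411Setting (isFrobenioid_arithAlong F₁ ρ₁ hρ₁) (isFrobenioid_arithAlong F₂ ρ₂ hρ₂) Ψ
    (cor411Setting_arithAlong F₁ ρ₁ hρ₁ F₂ ρ₂ hρ₂ hZ₁ hZ₂ Ψ)

/-- **[FrdI] Cor. 4.11 (iv), the consumer data, at `Ψ : ℱ^⊛(¹𝒟^⊚) ⥲ ℱ^⊛(²𝒟^⊚)`** (p. 92; Thm. 4.9 pp. 88–90):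
`Ψ^Base : ℬ(G₁)⁰ ⥤ ℬ(G₂)⁰` with its `1`-unique square, `η : Base₂ ∘ Ψ ≅ Ψ^Base ∘ Base₁`, a divisor-monoid
isomorphism `Ψ^Φ : Φ^⊛₁ ⥲ Φ^⊛₂` over `Ψ^Base`, "`Ψ` preserves `deg_Fr`", the divisor formula
`Div(Ψ φ) = η_A^* Ψ^Φ(Div φ)` on EVERY arrow, the typed rigidity clause and the rigid composites — L1's
`FrdI.exists_cor411iv_data_ofFunctor` with every antecedent discharged here (rational at THE birationalization,
`Cor411Setting`), for slim `G₁, G₂`. ([IUTchI] Ex 5.1 (iii) p.125) [claim: Mochizuki2012, status: disputed] -/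
theorem exists_cor411iv_data_arithAlong (hZ₁ : IsSlimGroup G₁) (hZ₂ : IsSlimGroup G₂)
    (Ψ : (arithAlong F₁ ρ₁ hρ₁).ModelGlobalFrobenioid ≌ (arithAlong F₂ ρ₂ hρ₂).ModelGlobalFrobenioid) :
    ∃ (ΨBase : BaseCat G₁ ⥤ BaseCat G₂)
      (E' : (ModelFrobenioid.data (arithAlong F₁ ρ₁ hρ₁).Φ (arithAlong F₁ ρ₁ hρ₁).B
          (arithAlong F₁ ρ₁ hρ₁).div).DivisorMonoidIsoOverBase
        (ModelFrobenioid.data (arithAlong F₂ ρ₂ hρ₂).Φ (arithAlong F₂ ρ₂ hρ₂).B (arithAlong F₂ ρ₂ hρ₂).div) ΨBase)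
      (η : Ψ.functor ⋙ (arithAlong F₂ ρ₂ hρ₂).modelBase ≅ (arithAlong F₁ ρ₁ hρ₁).modelBase ⋙ ΨBase),
      PreFrobenioidData.OneUniqueSquare Ψ.functor (arithAlong F₁ ρ₁ hρ₁).modelBase (arithAlong F₂ ρ₂ hρ₂).modelBase
          ΨBase ∧
      PreFrobenioidData.PreservesDegFr
        (ModelFrobenioid.data (arithAlong F₁ ρ₁ hρ₁).Φ (arithAlong F₁ ρ₁ hρ₁).B (arithAlong F₁ ρ₁ hρ₁).div)
        (ModelFrobenioid.data (arithAlong F₂ ρ₂ hρ₂).Φ (arithAlong F₂ ρ₂ hρ₂).B (arithAlong F₂ ρ₂ hρ₂).div) Ψ ∧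
      (∀ ⦃A B : (arithAlong F₁ ρ₁ hρ₁).ModelGlobalFrobenioid⦄ (φ : A ⟶ B),
        ModelFrobenioid.div (Ψ.functor.map φ) =
          Literature.AlgebraicGeometry.Frobenioids.pull (arithAlong F₂ ρ₂ hρ₂).Φ (η.hom.app A) (E'.iso A.base (ModelFrobenioid.div φ))) ∧
      (ModelFrobenioid.data (arithAlong F₁ ρ₁ hρ₁).Φ (arithAlong F₁ ρ₁ hρ₁).B (arithAlong F₁ ρ₁ hρ₁).div).Cor411ivRigid
        (ModelFrobenioid.data (arithAlong F₂ ρ₂ hρ₂).Φ (arithAlong F₂ ρ₂ hρ₂).B (arithAlong F₂ ρ₂ hρ₂).div)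
        Ψ ΨBase E' ∧
      IsRigidFunctor (Ψ.functor ⋙ (arithAlong F₂ ρ₂ hρ₂).modelBase) ∧
      IsRigidFunctor ((arithAlong F₁ ρ₁ hρ₁).modelBase ⋙ ΨBase) := by
  obtain ⟨ΨBase, E', η, hsq, hdeg, hdiv, hrigid, hslim⟩ :=
    FrdI.exists_cor411iv_data_ofFunctor (isFrobenioid_arithAlong F₁ ρ₁ hρ₁) (isFrobenioid_arithAlong F₂ ρ₂ hρ₂)
      (objectwise_isPerfFactorial_arithAlong F₁ ρ₁ hρ₁) (objectwise_isPerfFactorial_arithAlong F₂ ρ₂ hρ₂)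
      (isRational_biratData_arithAlong F₁ ρ₁ hρ₁) Ψ (cor411Setting_arithAlong F₁ ρ₁ hρ₁ F₂ ρ₂ hρ₂ hZ₁ hZ₂ Ψ)
  obtain ⟨hr₁, hr₂⟩ := hslim (isSlim_baseCat_of_isSlimGroup G₁ hZ₁) (isSlim_baseCat_of_isSlimGroup G₂ hZ₂)
  exact ⟨ΨBase, E', η, hsq, hdeg, hdiv, hrigid, hr₁, hr₂⟩

end AlongTwo

end GlobalDivisorData

end Literature.IUT.HodgeTheaters

end
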